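/- Free-seat work of WIDTH SEAT `ym-line-cbag-p1-w2` (prover-ym-line-cbag-p1-w2-g17-0), route `EguchiKawaiDirectionLadder`
(ideator ym-idea-2, LINE 8), crux `TripleSmallBallMargin` (stmt-QuantumFields-27724), LEAD g24's S10-D «MARGIN ARITHMETIC» prefab
(STATUS 15:19Z, → w2): the two generic block-size bookkeeping facts of the crux assembly — (D1) the block-size entropy
`Σ_c n_c² log(N/n_c) ≤ N²/e` and (D2) the small-block loss `Σ_{n_c ≤ βNt} C(n_c,2)·|log t| ≤ βN²/(2e)` (both from the tree's
`x log(1/x) ≤ 1/e`).  Pure real arithmetic; ROUTE-INDEPENDENT.  Nothing here bears on the Yang–Mills mass gap (barrier-ledger line onto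
`EguchiKawaiBreakdown`). -/
import Summits.QuantumFields.YangMills.Theorems.EguchiKawaiDirectionLadderRigidityDefs
import Literature.Analysis.Complex.LogDerivativeLemma
import HarnessLib

/-!
# Route `EguchiKawaiDirectionLadder`, crux `TripleSmallBallMargin`: margin arithmetic (S10-D prefab)

In the crux assembly the within-block bounds are applied on blocks of sizes `n_c` (`Σ_c n_c ≤ N`) at the GLOBAL budget `Nt`, which
produces two kinds of junk: the budget inflation `(N/n_c)^{C(n_c,2)}` per block, and the blocks too small for the budget (`n_c ≲ βNt`,
where the block bound is vacuous and their `C(n_c,2)` pairs are simply not charged).  Both are `e^{O(N²)}`, uniformly in `t ∈ (0,1]`: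

* `mul_neg_log_le` (`t·(−log t) ≤ e⁻¹`, from the tree's `Literature.Analysis.Complex.mul_log_inv_le_exp_neg_one`);
* (D1) `sum_sq_mul_log_div_le` — `Σ_c n_c²·log(N/n_c) ≤ N²·e⁻¹` whenever `Σ_c n_c ≤ N` (so `∏_c (N/n_c)^{n_c²} ≤ exp(N²/e)`);
* (D2) `sum_smallBlocks_pairs_mul_neg_log_le` — `Σ_{c : n_c ≤ βNt} (n_c(n_c−1)/2)·(−log t) ≤ β·N²/2·e⁻¹` for `0 < t ≤ 1`, `β ≥ 0`
  (so dropping the small blocks costs `t^{−βN²/(2e)·(1/|log t|)·…} = exp(O(N²))`).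
-/

set_option autoImplicit false

noncomputable section

namespace Summit.QuantumFields.YangMills.Theorems.EguchiKawaiDirectionLadder

/-! ### `t·|log t| ≤ 1/e` (from the tree's `Literature.Analysis.Complex.mul_log_inv_le_exp_neg_one`) -/

/-- `t · (−log t) ≤ e⁻¹` for `t > 0` (the tree's `t·log(1/t) ≤ e⁻¹`, rewritten). -/
theorem mul_neg_log_le {t : ℝ} (ht : 0 < t) : t * (-Real.log t) ≤ Real.exp (-1) := by
  have h := Literature.Analysis.Complex.mul_log_inv_le_exp_neg_one ht
  rwa [Real.log_inv] at h

/-! ### (D1) block-size entropy -/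

/-- One block: `n² · log(N/n) ≤ N · n · e⁻¹` for naturals `n ≤ N` (also when `n = 0`). -/
theorem sq_mul_log_div_le {n N : ℕ} (hnN : n ≤ N) :
    (n : ℝ) ^ 2 * Real.log ((N : ℝ) / n) ≤ (N : ℝ) * n * Real.exp (-1) := by
  rcases Nat.eq_zero_or_pos n with hn | hn
  · subst hn; simp
  have hnr : (0 : ℝ) < n := by exact_mod_cast hn
  have hNr : (0 : ℝ) < N := by exact_mod_cast lt_of_lt_of_le hn hnN
  -- `u = n/N ∈ (0,1]`, `n² log(N/n) = N n · (u log(1/u))`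
  have hu : (0 : ℝ) < n / N := div_pos hnr hNr
  have hkey := Literature.Analysis.Complex.mul_log_inv_le_exp_neg_one hu
  have hinv : ((n : ℝ) / N)⁻¹ = (N : ℝ) / n := by rw [inv_div]
  rw [hinv] at hkey
  have hexpand : (n : ℝ) ^ 2 * Real.log ((N : ℝ) / n) = (N : ℝ) * n * ((n : ℝ) / N * Real.log ((N : ℝ) / n)) := by
    field_simp
  rw [hexpand]
  exact mul_le_mul_of_nonneg_left hkey (by positivity)

/-- **(D1) Block-size entropy**: `Σ_c n_c² · log(N/n_c) ≤ N² · e⁻¹` for block sizes `n_c` with `Σ_c n_c ≤ N`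
(equivalently `∏_c (N/n_c)^{n_c²} ≤ exp(N²/e)`: the budget inflation of the within-block bounds is `e^{O(N²)}`). -/
theorem sum_sq_mul_log_div_le {m : ℕ} (n : Fin m → ℕ) (N : ℕ) (hsum : ∑ c, n c ≤ N) :
    ∑ c, (n c : ℝ) ^ 2 * Real.log ((N : ℝ) / n c) ≤ (N : ℝ) ^ 2 * Real.exp (-1) := by
  have hle : ∀ c, n c ≤ N := fun c =>
    le_trans (Finset.single_le_sum (fun _ _ => Nat.zero_le _) (Finset.mem_univ c)) hsum
  have hsumR : ∑ c, (n c : ℝ) ≤ N := by exact_mod_cast hsum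
  calc ∑ c, (n c : ℝ) ^ 2 * Real.log ((N : ℝ) / n c) ≤ ∑ c, (N : ℝ) * n c * Real.exp (-1) :=
        Finset.sum_le_sum fun c _ => sq_mul_log_div_le (hle c)
    _ = (N : ℝ) * Real.exp (-1) * ∑ c, (n c : ℝ) := by rw [Finset.mul_sum]; exact Finset.sum_congr rfl fun c _ => by ring
    _ ≤ (N : ℝ) * Real.exp (-1) * N := mul_le_mul_of_nonneg_left hsumR (by positivity)
    _ = (N : ℝ) ^ 2 * Real.exp (-1) := by ring

/-- (D1), product form: `Σ_c C(n_c,2)·log(N/n_c) ≤ N²/(2e)` is what `∏_c (N/n_c)^{C(n_c,2)}` costs; here the convenient bound with the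
full square, `Σ_c (n_c(n_c−1)/2) · log(N/n_c) ≤ N² · e⁻¹ / 2`, for `Σ n_c ≤ N`. -/
theorem sum_pairs_mul_log_div_le {m : ℕ} (n : Fin m → ℕ) (N : ℕ) (hsum : ∑ c, n c ≤ N) :
    ∑ c, ((n c : ℝ) * ((n c : ℝ) - 1) / 2) * Real.log ((N : ℝ) / n c) ≤ (N : ℝ) ^ 2 * Real.exp (-1) / 2 := by
  have hle : ∀ c, n c ≤ N := fun c =>
    le_trans (Finset.single_le_sum (fun _ _ => Nat.zero_le _) (Finset.mem_univ c)) hsum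
  have hterm : ∀ c, ((n c : ℝ) * ((n c : ℝ) - 1) / 2) * Real.log ((N : ℝ) / n c) ≤
      ((n c : ℝ) ^ 2 * Real.log ((N : ℝ) / n c)) / 2 := by
    intro c
    rcases Nat.eq_zero_or_pos (n c) with h0 | hpos
    · simp [h0]
    · have hnr : (1 : ℝ) ≤ n c := by exact_mod_cast hpos
      have hNr : (n c : ℝ) ≤ N := by exact_mod_cast hle c
      have hlog : 0 ≤ Real.log ((N : ℝ) / n c) :=
        Real.log_nonneg ((one_le_div (by linarith)).2 hNr)
      have : (n c : ℝ) * ((n c : ℝ) - 1) / 2 ≤ (n c : ℝ) ^ 2 / 2 := by nlinarith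
      calc ((n c : ℝ) * ((n c : ℝ) - 1) / 2) * Real.log ((N : ℝ) / n c)
          ≤ ((n c : ℝ) ^ 2 / 2) * Real.log ((N : ℝ) / n c) := mul_le_mul_of_nonneg_right this hlog
        _ = ((n c : ℝ) ^ 2 * Real.log ((N : ℝ) / n c)) / 2 := by ring
  calc ∑ c, ((n c : ℝ) * ((n c : ℝ) - 1) / 2) * Real.log ((N : ℝ) / n c)
      ≤ ∑ c, ((n c : ℝ) ^ 2 * Real.log ((N : ℝ) / n c)) / 2 := Finset.sum_le_sum fun c _ => hterm c
    _ = (∑ c, (n c : ℝ) ^ 2 * Real.log ((N : ℝ) / n c)) / 2 := by rw [Finset.sum_div]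
    _ ≤ (N : ℝ) ^ 2 * Real.exp (-1) / 2 := by
        have := sum_sq_mul_log_div_le n N hsum
        linarith

/-! ### (D2) small blocks -/

/-- **(D2) Small-block loss**: for `0 < t ≤ 1`, `β ≥ 0` and block sizes with `Σ_c n_c ≤ N`, the pairs of the blocks with
`n_c ≤ β·N·t` weigh at most `Σ_{c : n_c ≤ βNt} (n_c(n_c−1)/2)·(−log t) ≤ β·N²/2·e⁻¹` (`t·|log t| ≤ e⁻¹`): not charging them costs
only `exp(O(N²))`. -/
theorem sum_smallBlocks_pairs_mul_neg_log_le {m : ℕ} (n : Fin m → ℕ) (N : ℕ) (hsum : ∑ c, n c ≤ N) {β t : ℝ}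
    (hβ : 0 ≤ β) (ht : 0 < t) (ht1 : t ≤ 1) :
    ∑ c, (if (n c : ℝ) ≤ β * N * t then ((n c : ℝ) * ((n c : ℝ) - 1) / 2) * (-Real.log t) else 0) ≤
      β * (N : ℝ) ^ 2 / 2 * Real.exp (-1) := by
  have hlog : 0 ≤ -Real.log t := by have := Real.log_nonpos ht.le ht1; linarith
  have htl : t * (-Real.log t) ≤ Real.exp (-1) := mul_neg_log_le ht
  have hsumR : ∑ c, (n c : ℝ) ≤ N := by exact_mod_cast hsum
  have hterm : ∀ c, (if (n c : ℝ) ≤ β * N * t then ((n c : ℝ) * ((n c : ℝ) - 1) / 2) * (-Real.log t) else 0) ≤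
      (β * N * Real.exp (-1) / 2) * (n c : ℝ) := by
    intro c
    have hn0 : (0 : ℝ) ≤ n c := by positivity
    split_ifs with hsmall
    · -- `n(n−1)/2 ≤ n·(βNt)/2`, then `t(−log t) ≤ e⁻¹`
      have h1 : (n c : ℝ) * ((n c : ℝ) - 1) / 2 ≤ (n c : ℝ) * (β * N * t) / 2 := by nlinarith
      calc ((n c : ℝ) * ((n c : ℝ) - 1) / 2) * (-Real.log t)
          ≤ ((n c : ℝ) * (β * N * t) / 2) * (-Real.log t) := mul_le_mul_of_nonneg_right h1 hlog
        _ = (β * N / 2) * (n c : ℝ) * (t * (-Real.log t)) := by ring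
        _ ≤ (β * N / 2) * (n c : ℝ) * Real.exp (-1) :=
            mul_le_mul_of_nonneg_left htl (by positivity)
        _ = (β * N * Real.exp (-1) / 2) * (n c : ℝ) := by ring
    · positivity
  calc ∑ c, (if (n c : ℝ) ≤ β * N * t then ((n c : ℝ) * ((n c : ℝ) - 1) / 2) * (-Real.log t) else 0)
      ≤ ∑ c, (β * N * Real.exp (-1) / 2) * (n c : ℝ) := Finset.sum_le_sum fun c _ => hterm c
    _ = (β * N * Real.exp (-1) / 2) * ∑ c, (n c : ℝ) := by rw [Finset.mul_sum]
    _ ≤ (β * N * Real.exp (-1) / 2) * N := mul_le_mul_of_nonneg_left hsumR (by positivity)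
    _ = β * (N : ℝ) ^ 2 / 2 * Real.exp (-1) := by ring

end Summit.QuantumFields.YangMills.Theorems.EguchiKawaiDirectionLadder

end
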